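/-
Copyright (c) 2026 the pub-hodgecm-mathlib formalisation cell (harness21).  Prover seat hodgecm-mathlib-K2E4-p14 (g5), Track B ∕ K2-LIT, h413 =
`stmt-HodgeConjecture-24833`, line `K2_E1_TraceFormulaBeta`, campaign «EIS-RANK-ONE» rung R6f(ii); DEAL «EIS-R6f-ii» `K2E1MaassSelbergU` of the dealer K2E1-plan (g3)
2026-09-04T05:13:55Z (road «B»), FILE 2∕2: the bracket evaluations on the idele class group and the rank-one MAASS–SELBERG RELATION, hypothesis-first.
-/
import Summits.HodgeConjecture.HodgeConjecture.Theorems.K2E1MaassSelbergFourBrackets   -- ★ p857577∕p857595 (this seat): §0 X → weight level, §1 four-bracket algebra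
import Summits.HodgeConjecture.HodgeConjecture.Theorems.K2E1TorusHeightMellin         -- ★ p857517 (this seat): the Mellin heads `∫ ‖x‖^s Ψ = (T₀^s∕s)·[Ψ]`, `[η] = 0`
import HarnessLib

/-!
# K2·E1 — `K2E1MaassSelbergU`: THE RANK-ONE MAASS–SELBERG RELATION FOR `U(J₃)` (and the `U(J₂)` weight), HYPOTHESIS-FIRST
# (campaign «EIS-RANK-ONE», rung R6f(ii), file 2∕2: `⟨Λ^T E f, Λ^T E f′⟩_X = c_μ·K·((T^{s₁}∕s₁)[Ψ₁] + (T^{s₂}∕s₂)[Ψ₂] − (T^{−s₂}∕s₂)[Ψ₃] − (T^{−s₁}∕s₁)[Ψ₄])`)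

Track B ∕ K2-LIT, crux h413 = `stmt-HodgeConjecture-24833`, route of record `HCCMUnconditional`; cell `hodgecm-mathlib`, squad K2, ENGINE E1.  Prover seat
`hodgecm-mathlib-K2E4-p14` (g5); DEAL «EIS-R6f-ii» of the dealer K2E1-plan (g3) 2026-09-04T05:13:55Z ∕ «=» 05:17:57Z («four Mellin outputs UNCOMBINED, the sub-tube hypothesis
explicit, the `[η] = 0` cross-term vanishing as a separate corollary»).  THEOREMS ONLY (no `def`, no `instance`, no notation, no named-fact hypothesis, no `sorry`); lane
`--supports stmt-HodgeConjecture-24833 --as helper` (count-neutral).  Closes no socket.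

THE MATHEMATICS [MoeglinWaldspurger1995, IV.2.1–IV.2.3; Arthur1980TraceFormulaII, §4; Garrett2018, §11.3].  After ★ §0 (X → `B(F)`-weight level, Weil's `c_μ`) and ★ §1 (the four
brackets `[𝟙_{≤T} f, f′]_β + [𝟙_{≤T} f, Mf′]_β − [𝟙_{>T} Mf, f′]_β − [𝟙_{>T} Mf, Mf′]_β`) of ★ `K2E1MaassSelbergFourBrackets`, each bracket is pushed to the idele class group
`E^×∖𝕀_E` by the (δ) weight-level unfolding of K2E4-p11 (`∫ (β g)·Ψ dν_G = K·∫_𝓕 (‖x‖·‖x‖)⁻¹ • Φ_Ψ x dν_I`, `Φ_Ψ ∘ d₀ =` the `K_U`-average of `Ψ` on the torus; ★ p857542 shape,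
export pending — a HYPOTHESIS here), where for flat sections `f = φ·H^z`, `Mf = (Mφ)·H^{2−z}` the idele-side densities are cut-off powers of the norm times a bounded
`E^×·M`-invariant weight: `Φ₁ = 𝟙_{‖x‖≤T}·‖x‖^{s₁+2}·Ψ₁`, `Φ₂ = 𝟙_{‖x‖≤T}·‖x‖^{s₂+2}·Ψ₂`, `Φ₃ = 𝟙_{T<‖x‖}·‖x‖^{−s₂+2}·Ψ₃`, `Φ₄ = 𝟙_{T<‖x‖}·‖x‖^{−s₁+2}·Ψ₄` with
`s₁ = z + conj z′ − 2`, `s₂ = z − conj z′` (the `+2` is `δ_B = H²`, eaten by the weight `(‖x‖·‖x‖)⁻¹`; at `N = 2`: `+1` and `‖x‖⁻¹`).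
* §1 THE FOUR EVALUATIONS (`K`-generic): `(‖x‖^m)⁻¹ • 𝟙_{≤T}‖x‖^{s+m}Ψ` integrates over `𝓕` to **`(T^s∕s)·[Ψ]`** and `(‖x‖^m)⁻¹ • 𝟙_{>T}‖x‖^{−s+m}Ψ` to **`(T^{−s}∕s)·[Ψ]`** (`m = 2, 1`;
  ★ p857517 `integrableOn_and_setIntegral_ideleNorm_cpow_mul_of_le ∕ _cpow_neg_mul_of_lt`, `[Ψ] = ∫_{𝓕 ∩ {‖x‖≤1}} ‖x‖·Ψ`), with integrability on `𝓕`.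
* §2 **`maassSelberg_inner_truncation_three`** — the relation on the SUB-TUBE `0 < Re s₁`, `0 < Re s₂` (i.e. `Re z + Re z′ > 2` and `Re z′ < Re z`), every analytic input by name:
  §0∕§1 of ★ FourBrackets (`hSiegel`, `hCT`, `hsum`, `hAVG`, `hCT′`, `hadj`, `hM′ψ`, `hi₁…₅`, `Λ′` bounded `G(F)`-invariant Borel), (δ)×4 (`hδ₁…₄`), the density shapes (`hΦ₁…₄`):
  **`⟨Λ^T E f, Λ′⟩_X = c_μ·K·( (T^{s₁}∕s₁)[Ψ₁] + (T^{s₂}∕s₂)[Ψ₂] − (T^{−s₂}∕s₂)[Ψ₃] − (T^{−s₁}∕s₁)[Ψ₄] )`** — UNCOMBINED.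
* §3 **CROSS TERMS**: if `Ψ₂ = a₂·η`, `Ψ₃ = a₃·η` for a measurable bounded multiplicative `η` trivial on `E^×·M` with `η ≢ 1` (the torus characters of `f`, `f′` differ after the
  `d₀`-push; the `U(1)`-fibre case is ★ p857588), the two middle terms vanish (★ p857517 `bracket_character_eq_zero`).
HONEST LABEL: HC_CM is proved only modulo the 7 printed citations (2 remaining named inputs: hLiu418 = `stmt-HodgeConjecture-24832`, h413 = `stmt-HodgeConjecture-24833`) until rung 0
closes; this file asserts no named fact and closes no socket.
References: [MoeglinWaldspurger1995] C. Mœglin, J.-L. Waldspurger, *Spectral Decomposition and Eisenstein Series* (1995), IV.2.1–IV.2.3 · [Arthur1980TraceFormulaII] J. Arthur,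
Compositio Math. 40 (1980), §4 · [Garrett2018] P. Garrett, *Modern Analysis of Automorphic Forms by Example* (2018), §11.3 · [CasselsFrohlichANT1967] J. Tate, Ch. XV §4.4.
-/

set_option autoImplicit false
-- the mandated namespace repeats the single-problem summit's segment (`HodgeConjecture.HodgeConjecture`)
set_option linter.dupNamespace false

noncomputable section

open MeasureTheory Measure NumberField IsDedekindDomain Set MulAction
open scoped ENNReal NNReal ComplexConjugate
open Literature.MeasureTheory.Group Literature.NumberTheory
open Literature.NumberTheory.Automorphic Literature.NumberTheory.Automorphic.UnitaryGroup
open Summit.HodgeConjecture.HodgeConjecture.Cruxes.H413.K2E1BorelEisensteinU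
open Summit.HodgeConjecture.HodgeConjecture.Cruxes.H413.K2E1IdeleClassMellinWeighted
open Summit.HodgeConjecture.HodgeConjecture.Cruxes.H413.K2E1TorusHeightMellin
open Summit.HodgeConjecture.HodgeConjecture.Cruxes.H413.K2E1MaassSelbergFourBrackets

namespace Summit.HodgeConjecture.HodgeConjecture.Cruxes.H413.K2E1MaassSelbergU

/-! ## §1 The four bracket evaluations on an idele class domain (`K`-generic; weights `(‖x‖·‖x‖)⁻¹` for `U(J₃)`, `‖x‖⁻¹` for `U(J₂)`) -/

section Idele

variable {K : Type} [Field K] [NumberField K]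

/-- `(r·r)⁻¹ • (r^{s+2}·w) = r^s·w` for `r > 0` (the `δ_B = H²` weight of `U(J₃)` eats two units of exponent). [folklore] -/
theorem inv_mul_self_smul_cpow_add_two {r : ℝ} (hr : 0 < r) (s w : ℂ) :
    ((r * r)⁻¹ : ℝ) • (((r : ℂ) ^ (s + 2)) * w) = (r : ℂ) ^ s * w := by
  have hr' : (r : ℂ) ≠ 0 := Complex.ofReal_ne_zero.2 hr.ne'
  rw [Complex.real_smul, Complex.cpow_add _ _ hr', Complex.cpow_two, Complex.ofReal_inv, Complex.ofReal_mul]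
  field_simp

/-- `r⁻¹ • (r^{s+1}·w) = r^s·w` for `r > 0` (the `δ_B = H` weight of `U(J₂)`). [folklore] -/
theorem inv_smul_cpow_add_one {r : ℝ} (hr : 0 < r) (s w : ℂ) :
    ((r)⁻¹ : ℝ) • (((r : ℂ) ^ (s + 1)) * w) = (r : ℂ) ^ s * w := by
  have hr' : (r : ℂ) ≠ 0 := Complex.ofReal_ne_zero.2 hr.ne'
  rw [Complex.real_smul, Complex.cpow_add _ _ hr', Complex.cpow_one, Complex.ofReal_inv]
  field_simp

variable [MeasurableSpace (GaloisRepresentations.ideleGroup K)] [BorelSpace (GaloisRepresentations.ideleGroup K)]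

omit [BorelSpace (GaloisRepresentations.ideleGroup K)] in
/-- Transport of an `IntegrableOn ∧ ∫ =` package along a cut-off: if `w • 𝟙_S G = 𝟙_S g` pointwise, `S` is Borel, and `g` is integrable on `S ∩ 𝓕` with integral `I`, then
`w • 𝟙_S G` is integrable on `𝓕` with integral `I`. [folklore] -/
theorem integrableOn_and_setIntegral_of_indicator_eq (ν : Measure (GaloisRepresentations.ideleGroup K)) {𝓕 S : Set (GaloisRepresentations.ideleGroup K)}
    (hS : MeasurableSet S) {Θ g : GaloisRepresentations.ideleGroup K → ℂ} (hΘ : ∀ x, Θ x = S.indicator g x) {I : ℂ}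
    (hg : IntegrableOn g (S ∩ 𝓕) ν ∧ ∫ x in S ∩ 𝓕, g x ∂ν = I) :
    IntegrableOn Θ 𝓕 ν ∧ ∫ x in 𝓕, Θ x ∂ν = I := by
  have hΘ' : Θ = S.indicator g := funext hΘ
  rw [hΘ']
  refine ⟨?_, ?_⟩
  · refine (integrable_indicator_iff hS).2 ?_
    rw [IntegrableOn, Measure.restrict_restrict hS]
    exact hg.1
  · rw [integral_indicator hS, Measure.restrict_restrict hS, hg.2]

/-- **BRACKET EVALUATION, `{‖x‖ ≤ T₀}`, weight `(‖x‖·‖x‖)⁻¹`** (`U(J₃)`): for `Ψ` measurable, bounded, `K^×`- and `M`-invariant, `Re s > 0`, `T₀ > 0`,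
`x ↦ (‖x‖·‖x‖)⁻¹ • 𝟙_{‖x‖≤T₀}(x)·‖x‖^{s+2}·Ψ(x)` is integrable on `𝓕` and integrates to **`(T₀^s∕s)·[Ψ]`**, `[Ψ] = ∫_{𝓕 ∩ {‖x‖≤1}} ‖x‖·Ψ` (★ p857517).
[cite: MoeglinWaldspurger1995, IV.2.1] [cite: Arthur1980TraceFormulaII, §4] -/
theorem integrableOn_and_setIntegral_normSq_inv_smul_indicator_le (ν : Measure (GaloisRepresentations.ideleGroup K)) [ν.IsMulLeftInvariant]
    [IsFiniteMeasureOnCompacts ν] [ν.IsOpenPosMeasure] {𝓕 : Set (GaloisRepresentations.ideleGroup K)} (h𝓕 : IsIdeleClassDomain K 𝓕)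
    {Ψ : GaloisRepresentations.ideleGroup K → ℂ} (hΨ : Measurable Ψ) {C : ℝ} (hΨC : ∀ x, ‖Ψ x‖ ≤ C)
    (hΨK : ∀ k ∈ GaloisRepresentations.principalIdeles K, ∀ x, Ψ (k * x) = Ψ x)
    (hΨM : ∀ (r : ℝ≥0ˣ) (x : GaloisRepresentations.ideleGroup K), Ψ (posRealIdele K r * x) = Ψ x)
    {s : ℂ} (hs : 0 < s.re) {T₀ : ℝ} (hT : 0 < T₀) :
    IntegrableOn (fun x => ((IdeleClassGroup.ideleNorm K x : ℝ) * (IdeleClassGroup.ideleNorm K x : ℝ))⁻¹ •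
        {x | (IdeleClassGroup.ideleNorm K x : ℝ) ≤ T₀}.indicator (fun x => ((IdeleClassGroup.ideleNorm K x : ℝ) : ℂ) ^ (s + 2) * Ψ x) x) 𝓕 ν ∧
      ∫ x in 𝓕, ((IdeleClassGroup.ideleNorm K x : ℝ) * (IdeleClassGroup.ideleNorm K x : ℝ))⁻¹ •
          {x | (IdeleClassGroup.ideleNorm K x : ℝ) ≤ T₀}.indicator (fun x => ((IdeleClassGroup.ideleNorm K x : ℝ) : ℂ) ^ (s + 2) * Ψ x) x ∂ν =
        (((T₀ : ℝ) : ℂ) ^ s / s) * ∫ x in {x | (IdeleClassGroup.ideleNorm K x : ℝ) ≤ 1} ∩ 𝓕, ((IdeleClassGroup.ideleNorm K x : ℝ) : ℂ) * Ψ x ∂ν := by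
  have hS : MeasurableSet {x : GaloisRepresentations.ideleGroup K | (IdeleClassGroup.ideleNorm K x : ℝ) ≤ T₀} := by
    rw [setOf_ideleNorm_le_eq hT]; exact measurableSet_logNorm_preimage measurableSet_Iic
  refine integrableOn_and_setIntegral_of_indicator_eq ν hS (g := fun x => ((IdeleClassGroup.ideleNorm K x : ℝ) : ℂ) ^ s * Ψ x) (fun x => ?_)
    (integrableOn_and_setIntegral_ideleNorm_cpow_mul_of_le ν h𝓕 hΨ hΨC hΨK hΨM hs hT)
  by_cases hx : x ∈ {x : GaloisRepresentations.ideleGroup K | (IdeleClassGroup.ideleNorm K x : ℝ) ≤ T₀}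
  · rw [indicator_of_mem hx, indicator_of_mem hx, inv_mul_self_smul_cpow_add_two (ideleNorm_real_pos x)]
  · rw [indicator_of_notMem hx, indicator_of_notMem hx, smul_zero]

/-- **BRACKET EVALUATION, `{T₀ < ‖x‖}`, weight `(‖x‖·‖x‖)⁻¹`** (`U(J₃)`, the mirror): `(‖x‖·‖x‖)⁻¹ • 𝟙_{T₀<‖x‖}·‖x‖^{−s+2}·Ψ` is integrable on `𝓕` and integrates to
**`(T₀^{−s}∕s)·[Ψ]`** — the SAME bracket. [cite: MoeglinWaldspurger1995, IV.2.1] [cite: Arthur1980TraceFormulaII, §4] -/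
theorem integrableOn_and_setIntegral_normSq_inv_smul_indicator_lt (ν : Measure (GaloisRepresentations.ideleGroup K)) [ν.IsMulLeftInvariant]
    [IsFiniteMeasureOnCompacts ν] [ν.IsOpenPosMeasure] {𝓕 : Set (GaloisRepresentations.ideleGroup K)} (h𝓕 : IsIdeleClassDomain K 𝓕)
    {Ψ : GaloisRepresentations.ideleGroup K → ℂ} (hΨ : Measurable Ψ) {C : ℝ} (hΨC : ∀ x, ‖Ψ x‖ ≤ C)
    (hΨK : ∀ k ∈ GaloisRepresentations.principalIdeles K, ∀ x, Ψ (k * x) = Ψ x)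
    (hΨM : ∀ (r : ℝ≥0ˣ) (x : GaloisRepresentations.ideleGroup K), Ψ (posRealIdele K r * x) = Ψ x)
    {s : ℂ} (hs : 0 < s.re) {T₀ : ℝ} (hT : 0 < T₀) :
    IntegrableOn (fun x => ((IdeleClassGroup.ideleNorm K x : ℝ) * (IdeleClassGroup.ideleNorm K x : ℝ))⁻¹ •
        {x | T₀ < (IdeleClassGroup.ideleNorm K x : ℝ)}.indicator (fun x => ((IdeleClassGroup.ideleNorm K x : ℝ) : ℂ) ^ (-s + 2) * Ψ x) x) 𝓕 ν ∧
      ∫ x in 𝓕, ((IdeleClassGroup.ideleNorm K x : ℝ) * (IdeleClassGroup.ideleNorm K x : ℝ))⁻¹ •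
          {x | T₀ < (IdeleClassGroup.ideleNorm K x : ℝ)}.indicator (fun x => ((IdeleClassGroup.ideleNorm K x : ℝ) : ℂ) ^ (-s + 2) * Ψ x) x ∂ν =
        (((T₀ : ℝ) : ℂ) ^ (-s) / s) * ∫ x in {x | (IdeleClassGroup.ideleNorm K x : ℝ) ≤ 1} ∩ 𝓕, ((IdeleClassGroup.ideleNorm K x : ℝ) : ℂ) * Ψ x ∂ν := by
  have hS : MeasurableSet {x : GaloisRepresentations.ideleGroup K | T₀ < (IdeleClassGroup.ideleNorm K x : ℝ)} := by
    rw [setOf_lt_ideleNorm_eq hT]; exact measurableSet_logNorm_preimage measurableSet_Ioi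
  refine integrableOn_and_setIntegral_of_indicator_eq ν hS (g := fun x => ((IdeleClassGroup.ideleNorm K x : ℝ) : ℂ) ^ (-s) * Ψ x) (fun x => ?_)
    (integrableOn_and_setIntegral_ideleNorm_cpow_neg_mul_of_lt ν h𝓕 hΨ hΨC hΨK hΨM hs hT)
  by_cases hx : x ∈ {x : GaloisRepresentations.ideleGroup K | T₀ < (IdeleClassGroup.ideleNorm K x : ℝ)}
  · rw [indicator_of_mem hx, indicator_of_mem hx, inv_mul_self_smul_cpow_add_two (ideleNorm_real_pos x)]
  · rw [indicator_of_notMem hx, indicator_of_notMem hx, smul_zero]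

/-- **BRACKET EVALUATION, `{‖x‖ ≤ T₀}`, weight `‖x‖⁻¹`** (`U(J₂)`): `‖x‖⁻¹ • 𝟙_{‖x‖≤T₀}·‖x‖^{s+1}·Ψ` is integrable on `𝓕` with integral **`(T₀^s∕s)·[Ψ]`**.
[cite: MoeglinWaldspurger1995, IV.2.1] [cite: Arthur1980TraceFormulaII, §4] -/
theorem integrableOn_and_setIntegral_norm_inv_smul_indicator_le (ν : Measure (GaloisRepresentations.ideleGroup K)) [ν.IsMulLeftInvariant]
    [IsFiniteMeasureOnCompacts ν] [ν.IsOpenPosMeasure] {𝓕 : Set (GaloisRepresentations.ideleGroup K)} (h𝓕 : IsIdeleClassDomain K 𝓕)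
    {Ψ : GaloisRepresentations.ideleGroup K → ℂ} (hΨ : Measurable Ψ) {C : ℝ} (hΨC : ∀ x, ‖Ψ x‖ ≤ C)
    (hΨK : ∀ k ∈ GaloisRepresentations.principalIdeles K, ∀ x, Ψ (k * x) = Ψ x)
    (hΨM : ∀ (r : ℝ≥0ˣ) (x : GaloisRepresentations.ideleGroup K), Ψ (posRealIdele K r * x) = Ψ x)
    {s : ℂ} (hs : 0 < s.re) {T₀ : ℝ} (hT : 0 < T₀) :
    IntegrableOn (fun x => ((IdeleClassGroup.ideleNorm K x : ℝ))⁻¹ •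
        {x | (IdeleClassGroup.ideleNorm K x : ℝ) ≤ T₀}.indicator (fun x => ((IdeleClassGroup.ideleNorm K x : ℝ) : ℂ) ^ (s + 1) * Ψ x) x) 𝓕 ν ∧
      ∫ x in 𝓕, ((IdeleClassGroup.ideleNorm K x : ℝ))⁻¹ •
          {x | (IdeleClassGroup.ideleNorm K x : ℝ) ≤ T₀}.indicator (fun x => ((IdeleClassGroup.ideleNorm K x : ℝ) : ℂ) ^ (s + 1) * Ψ x) x ∂ν =
        (((T₀ : ℝ) : ℂ) ^ s / s) * ∫ x in {x | (IdeleClassGroup.ideleNorm K x : ℝ) ≤ 1} ∩ 𝓕, ((IdeleClassGroup.ideleNorm K x : ℝ) : ℂ) * Ψ x ∂ν := by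
  have hS : MeasurableSet {x : GaloisRepresentations.ideleGroup K | (IdeleClassGroup.ideleNorm K x : ℝ) ≤ T₀} := by
    rw [setOf_ideleNorm_le_eq hT]; exact measurableSet_logNorm_preimage measurableSet_Iic
  refine integrableOn_and_setIntegral_of_indicator_eq ν hS (g := fun x => ((IdeleClassGroup.ideleNorm K x : ℝ) : ℂ) ^ s * Ψ x) (fun x => ?_)
    (integrableOn_and_setIntegral_ideleNorm_cpow_mul_of_le ν h𝓕 hΨ hΨC hΨK hΨM hs hT)
  by_cases hx : x ∈ {x : GaloisRepresentations.ideleGroup K | (IdeleClassGroup.ideleNorm K x : ℝ) ≤ T₀}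
  · rw [indicator_of_mem hx, indicator_of_mem hx, inv_smul_cpow_add_one (ideleNorm_real_pos x)]
  · rw [indicator_of_notMem hx, indicator_of_notMem hx, smul_zero]

/-- **BRACKET EVALUATION, `{T₀ < ‖x‖}`, weight `‖x‖⁻¹`** (`U(J₂)`, mirror): `‖x‖⁻¹ • 𝟙_{T₀<‖x‖}·‖x‖^{−s+1}·Ψ` is integrable on `𝓕` with integral **`(T₀^{−s}∕s)·[Ψ]`**.
[cite: MoeglinWaldspurger1995, IV.2.1] [cite: Arthur1980TraceFormulaII, §4] -/
theorem integrableOn_and_setIntegral_norm_inv_smul_indicator_lt (ν : Measure (GaloisRepresentations.ideleGroup K)) [ν.IsMulLeftInvariant]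
    [IsFiniteMeasureOnCompacts ν] [ν.IsOpenPosMeasure] {𝓕 : Set (GaloisRepresentations.ideleGroup K)} (h𝓕 : IsIdeleClassDomain K 𝓕)
    {Ψ : GaloisRepresentations.ideleGroup K → ℂ} (hΨ : Measurable Ψ) {C : ℝ} (hΨC : ∀ x, ‖Ψ x‖ ≤ C)
    (hΨK : ∀ k ∈ GaloisRepresentations.principalIdeles K, ∀ x, Ψ (k * x) = Ψ x)
    (hΨM : ∀ (r : ℝ≥0ˣ) (x : GaloisRepresentations.ideleGroup K), Ψ (posRealIdele K r * x) = Ψ x)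
    {s : ℂ} (hs : 0 < s.re) {T₀ : ℝ} (hT : 0 < T₀) :
    IntegrableOn (fun x => ((IdeleClassGroup.ideleNorm K x : ℝ))⁻¹ •
        {x | T₀ < (IdeleClassGroup.ideleNorm K x : ℝ)}.indicator (fun x => ((IdeleClassGroup.ideleNorm K x : ℝ) : ℂ) ^ (-s + 1) * Ψ x) x) 𝓕 ν ∧
      ∫ x in 𝓕, ((IdeleClassGroup.ideleNorm K x : ℝ))⁻¹ •
          {x | T₀ < (IdeleClassGroup.ideleNorm K x : ℝ)}.indicator (fun x => ((IdeleClassGroup.ideleNorm K x : ℝ) : ℂ) ^ (-s + 1) * Ψ x) x ∂ν =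
        (((T₀ : ℝ) : ℂ) ^ (-s) / s) * ∫ x in {x | (IdeleClassGroup.ideleNorm K x : ℝ) ≤ 1} ∩ 𝓕, ((IdeleClassGroup.ideleNorm K x : ℝ) : ℂ) * Ψ x ∂ν := by
  have hS : MeasurableSet {x : GaloisRepresentations.ideleGroup K | T₀ < (IdeleClassGroup.ideleNorm K x : ℝ)} := by
    rw [setOf_lt_ideleNorm_eq hT]; exact measurableSet_logNorm_preimage measurableSet_Ioi
  refine integrableOn_and_setIntegral_of_indicator_eq ν hS (g := fun x => ((IdeleClassGroup.ideleNorm K x : ℝ) : ℂ) ^ (-s) * Ψ x) (fun x => ?_)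
    (integrableOn_and_setIntegral_ideleNorm_cpow_neg_mul_of_lt ν h𝓕 hΨ hΨC hΨK hΨM hs hT)
  by_cases hx : x ∈ {x : GaloisRepresentations.ideleGroup K | T₀ < (IdeleClassGroup.ideleNorm K x : ℝ)}
  · rw [indicator_of_mem hx, indicator_of_mem hx, inv_smul_cpow_add_one (ideleNorm_real_pos x)]
  · rw [indicator_of_notMem hx, indicator_of_notMem hx, smul_zero]

end Idele

/-! ## §2 THE MAASS–SELBERG RELATION FOR `U(J₃)` ON THE SUB-TUBE (hypothesis-first, four Mellin outputs uncombined) -/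

section Three

open AdelicGroupData
open Summit.HodgeConjecture.HodgeConjecture.Cruxes.H413.K2E1TruncatedEisensteinExplicit (siegel_three)

variable {F E : Type} [Field F] [NumberField F] [Field E] [NumberField E] [Algebra F E] {c : E ≃ₐ[F] E}
variable [MeasurableSpace (quasiSplit F E c 3).Adelic] [BorelSpace (quasiSplit F E c 3).Adelic]
variable [MeasurableSpace (adelicUnipotent F E c 3)]
variable [MeasurableSpace (AdeleRing (𝓞 E) E)ˣ] [BorelSpace (AdeleRing (𝓞 E) E)ˣ]

/-- **THE RANK-ONE MAASS–SELBERG RELATION FOR `U(J₃)`, HYPOTHESIS-FIRST, ON THE SUB-TUBE `0 < Re s₁`, `0 < Re s₂`** (`s₁ = z + conj z′ − 2`, `s₂ = z − conj z′` for flat sections of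
exponents `z, z′`; road «B» steps (1)–(7) assembled BY NAME).  `μ` automorphic on `X`, `ν_G` inversion-invariant Haar, `ν_I` left-invariant on `𝕀_E` with idele class domain `𝓕_I`: there is
ONE `c_μ > 0` (Weil, ★ §0) such that for every covering weight `β` of `B(F)♯`, `T ≥ 1`, Borel left-`B(F)`-invariant `f, Mf, f′, Mf′` with `E(f)_B = f + Mf` on `{H > T}` and `E(f)`
convergent, bounded Borel `G(F)`-invariant `Λ′` (= `Λ^T E f′`, ★ R6e) with `∫⁻ β‖ψ‖ₑ < ∞`, the averaging∕constant-term∕adjoint∕R6a inputs of ★ §1 (`hAVG`, `hCT′`, `hadj`, `hM′ψ`,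
`hi₁…₅`), and the four weight-level-to-idele-class evaluations `hδ₁…₄` ((δ) of K2E4-p11 composed with the flat-section densities; one constant `Kδ`) with bounded measurable
`E^×·M`-invariant idele weights `Ψ₁…Ψ₄`:
**`∫_X quotFun (Λ^T E f) · conj (quotFun Λ′) dμ = c_μ · Kδ · ( (T^{s₁}∕s₁)·[Ψ₁] + (T^{s₂}∕s₂)·[Ψ₂] − (T^{−s₂}∕s₂)·[Ψ₃] − (T^{−s₁}∕s₁)·[Ψ₄] )`**, `[Ψ] = ∫_{𝓕_I ∩ {‖x‖≤1}} ‖x‖·Ψ dν_I`.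
[cite: MoeglinWaldspurger1995, IV.2.1–IV.2.3] [cite: Arthur1980TraceFormulaII, §4] [cite: Garrett2018, §11.3] -/
theorem maassSelberg_inner_truncation_three
    (μ : Measure (quasiSplit F E c 3).automorphicQuotient) [(quasiSplit F E c 3).IsAutomorphicMeasure μ]
    (νG : Measure (quasiSplit F E c 3).Adelic) [νG.IsHaarMeasure] [νG.IsInvInvariant]
    (νI : Measure (AdeleRing (𝓞 E) E)ˣ) [νI.IsMulLeftInvariant] [IsFiniteMeasureOnCompacts νI] [νI.IsOpenPosMeasure]
    {𝓕I : Set (AdeleRing (𝓞 E) E)ˣ} (h𝓕I : IsIdeleClassDomain E 𝓕I) :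
    ∃ cμ : ℝ, 0 < cμ ∧
      ∀ {β : (quasiSplit F E c 3).Adelic → ℝ≥0∞}, IsCoveringWeight ((arithmeticBorel F E c 3).map (quasiSplit F E c 3).arithmeticSubgroup.subtype) β →
      ∀ {ν : Measure (adelicUnipotent F E c 3)} {𝓕 : Set (adelicUnipotent F E c 3)} {T : ℝ≥0}, 1 ≤ T →
      ∀ {f Mf f' Mf' Λ' CT' : (quasiSplit F E c 3).Adelic → ℂ} {M M' : ((quasiSplit F E c 3).Adelic → ℂ) → ((quasiSplit F E c 3).Adelic → ℂ)},
      -- ★ §0 inputs (X → weight level)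
      Measurable f → Measurable Mf →
        (∀ b ∈ arithmeticBorel F E c 3, ∀ x : (quasiSplit F E c 3).Adelic, f ((b : (quasiSplit F E c 3).Adelic) * x) = f x) →
        (∀ b ∈ arithmeticBorel F E c 3, ∀ x : (quasiSplit F E c 3).Adelic, Mf ((b : (quasiSplit F E c 3).Adelic) * x) = Mf x) →
        (∀ x : (quasiSplit F E c 3).Adelic, T < borelHeight x → borelConstantTerm ν 𝓕 (eisensteinSeriesU f) x = f x + Mf x) →
        (∀ g : (quasiSplit F E c 3).Adelic,
          Summable fun q : Quotient (orbitRel ↥(borelU (c : E →+* E) ((StdForm.antidiagonal 3).over E)) ↥(unitaryGroupOfForm (c : E →+* E) ((StdForm.antidiagonal 3).over E))) =>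
            f ((quasiSplit F E c 3).toAdelic (q.out : ↥(unitaryGroupOfForm (c : E →+* E) ((StdForm.antidiagonal 3).over E))) * g)) →
        Measurable Λ' → (∀ (γ : (quasiSplit F E c 3).arithmeticSubgroup) (x : (quasiSplit F E c 3).Adelic), Λ' ((γ : (quasiSplit F E c 3).Adelic) * x) = Λ' x) →
        ∀ {M₁ : ℝ}, (∀ g, ‖Λ' g‖ ≤ M₁) →
        ∫⁻ g, β g * ‖{y : (quasiSplit F E c 3).Adelic | borelHeight y ≤ T}.indicator f g - {y : (quasiSplit F E c 3).Adelic | T < borelHeight y}.indicator Mf g‖ₑ ∂νG < ∞ →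
      -- ★ §1 inputs (averaging, two-piece constant term, adjoint, R6a, integrability)
        ∫ g, (β g).toReal • (({y : (quasiSplit F E c 3).Adelic | borelHeight y ≤ T}.indicator f g - {y : (quasiSplit F E c 3).Adelic | T < borelHeight y}.indicator Mf g) * conj (Λ' g)) ∂νG =
          ∫ g, (β g).toReal • (({y : (quasiSplit F E c 3).Adelic | borelHeight y ≤ T}.indicator f g - {y : (quasiSplit F E c 3).Adelic | T < borelHeight y}.indicator Mf g) * conj (CT' g)) ∂νG →
        (∀ g, CT' g = {y : (quasiSplit F E c 3).Adelic | borelHeight y ≤ T}.indicator (f' + Mf') g - M ({y : (quasiSplit F E c 3).Adelic | T < borelHeight y}.indicator (f' + Mf')) g) →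
        ∫ g, (β g).toReal • (({y : (quasiSplit F E c 3).Adelic | borelHeight y ≤ T}.indicator f g - {y : (quasiSplit F E c 3).Adelic | T < borelHeight y}.indicator Mf g) * conj (M ({y : (quasiSplit F E c 3).Adelic | T < borelHeight y}.indicator (f' + Mf')) g)) ∂νG =
          ∫ g, (β g).toReal • (M' (fun x => {y : (quasiSplit F E c 3).Adelic | borelHeight y ≤ T}.indicator f x - {y : (quasiSplit F E c 3).Adelic | T < borelHeight y}.indicator Mf x) g * conj ({y : (quasiSplit F E c 3).Adelic | T < borelHeight y}.indicator (f' + Mf') g)) ∂νG →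
        (∀ g, T < borelHeight g → M' (fun x => {y : (quasiSplit F E c 3).Adelic | borelHeight y ≤ T}.indicator f x - {y : (quasiSplit F E c 3).Adelic | T < borelHeight y}.indicator Mf x) g = Mf g) →
        Integrable (fun g => (β g).toReal • ({y : (quasiSplit F E c 3).Adelic | borelHeight y ≤ T}.indicator f g * conj (f' g))) νG →
        Integrable (fun g => (β g).toReal • ({y : (quasiSplit F E c 3).Adelic | borelHeight y ≤ T}.indicator f g * conj (Mf' g))) νG →
        Integrable (fun g => (β g).toReal • ({y : (quasiSplit F E c 3).Adelic | T < borelHeight y}.indicator Mf g * conj (f' g))) νG →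
        Integrable (fun g => (β g).toReal • ({y : (quasiSplit F E c 3).Adelic | T < borelHeight y}.indicator Mf g * conj (Mf' g))) νG →
        Integrable (fun g => (β g).toReal • (({y : (quasiSplit F E c 3).Adelic | borelHeight y ≤ T}.indicator f g - {y : (quasiSplit F E c 3).Adelic | T < borelHeight y}.indicator Mf g) * conj (M ({y : (quasiSplit F E c 3).Adelic | T < borelHeight y}.indicator (f' + Mf')) g))) νG →
      -- (δ) composed with the flat-section densities: weight level → idele class, one constant `Kδ`, exponents `s₁, s₂`, weights `Ψ₁…Ψ₄`
      ∀ {Kδ : ℝ} {s₁ s₂ : ℂ}, 0 < s₁.re → 0 < s₂.re → ∀ {Ψ₁ Ψ₂ Ψ₃ Ψ₄ : (AdeleRing (𝓞 E) E)ˣ → ℂ},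
      Measurable Ψ₁ → ∀ {C₁ : ℝ}, (∀ x, ‖Ψ₁ x‖ ≤ C₁) → (∀ k ∈ GaloisRepresentations.principalIdeles E, ∀ x, Ψ₁ (k * x) = Ψ₁ x) →
        (∀ (r : ℝ≥0ˣ) (x : (AdeleRing (𝓞 E) E)ˣ), Ψ₁ (posRealIdele E r * x) = Ψ₁ x) →
      Measurable Ψ₂ → ∀ {C₂ : ℝ}, (∀ x, ‖Ψ₂ x‖ ≤ C₂) → (∀ k ∈ GaloisRepresentations.principalIdeles E, ∀ x, Ψ₂ (k * x) = Ψ₂ x) →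
        (∀ (r : ℝ≥0ˣ) (x : (AdeleRing (𝓞 E) E)ˣ), Ψ₂ (posRealIdele E r * x) = Ψ₂ x) →
      Measurable Ψ₃ → ∀ {C₃ : ℝ}, (∀ x, ‖Ψ₃ x‖ ≤ C₃) → (∀ k ∈ GaloisRepresentations.principalIdeles E, ∀ x, Ψ₃ (k * x) = Ψ₃ x) →
        (∀ (r : ℝ≥0ˣ) (x : (AdeleRing (𝓞 E) E)ˣ), Ψ₃ (posRealIdele E r * x) = Ψ₃ x) →
      Measurable Ψ₄ → ∀ {C₄ : ℝ}, (∀ x, ‖Ψ₄ x‖ ≤ C₄) → (∀ k ∈ GaloisRepresentations.principalIdeles E, ∀ x, Ψ₄ (k * x) = Ψ₄ x) →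
        (∀ (r : ℝ≥0ˣ) (x : (AdeleRing (𝓞 E) E)ˣ), Ψ₄ (posRealIdele E r * x) = Ψ₄ x) →
        ∫ g, (β g).toReal • ({y : (quasiSplit F E c 3).Adelic | borelHeight y ≤ T}.indicator f g * conj (f' g)) ∂νG =
          (Kδ : ℂ) * ∫ x in 𝓕I, ((IdeleClassGroup.ideleNorm E x : ℝ) * (IdeleClassGroup.ideleNorm E x : ℝ))⁻¹ • {x : (AdeleRing (𝓞 E) E)ˣ | (IdeleClassGroup.ideleNorm E x : ℝ) ≤ (T : ℝ)}.indicator (fun x => ((IdeleClassGroup.ideleNorm E x : ℝ) : ℂ) ^ (s₁ + 2) * Ψ₁ x) x ∂νI →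
        ∫ g, (β g).toReal • ({y : (quasiSplit F E c 3).Adelic | borelHeight y ≤ T}.indicator f g * conj (Mf' g)) ∂νG =
          (Kδ : ℂ) * ∫ x in 𝓕I, ((IdeleClassGroup.ideleNorm E x : ℝ) * (IdeleClassGroup.ideleNorm E x : ℝ))⁻¹ • {x : (AdeleRing (𝓞 E) E)ˣ | (IdeleClassGroup.ideleNorm E x : ℝ) ≤ (T : ℝ)}.indicator (fun x => ((IdeleClassGroup.ideleNorm E x : ℝ) : ℂ) ^ (s₂ + 2) * Ψ₂ x) x ∂νI →
        ∫ g, (β g).toReal • ({y : (quasiSplit F E c 3).Adelic | T < borelHeight y}.indicator Mf g * conj (f' g)) ∂νG =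
          (Kδ : ℂ) * ∫ x in 𝓕I, ((IdeleClassGroup.ideleNorm E x : ℝ) * (IdeleClassGroup.ideleNorm E x : ℝ))⁻¹ • {x : (AdeleRing (𝓞 E) E)ˣ | (T : ℝ) < (IdeleClassGroup.ideleNorm E x : ℝ)}.indicator (fun x => ((IdeleClassGroup.ideleNorm E x : ℝ) : ℂ) ^ (-s₂ + 2) * Ψ₃ x) x ∂νI →
        ∫ g, (β g).toReal • ({y : (quasiSplit F E c 3).Adelic | T < borelHeight y}.indicator Mf g * conj (Mf' g)) ∂νG =
          (Kδ : ℂ) * ∫ x in 𝓕I, ((IdeleClassGroup.ideleNorm E x : ℝ) * (IdeleClassGroup.ideleNorm E x : ℝ))⁻¹ • {x : (AdeleRing (𝓞 E) E)ˣ | (T : ℝ) < (IdeleClassGroup.ideleNorm E x : ℝ)}.indicator (fun x => ((IdeleClassGroup.ideleNorm E x : ℝ) : ℂ) ^ (-s₁ + 2) * Ψ₄ x) x ∂νI →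
      -- THE RELATION
        ∫ x, (quasiSplit F E c 3).quotFun (truncation ν 𝓕 T (eisensteinSeriesU f)) x * conj ((quasiSplit F E c 3).quotFun Λ' x) ∂μ =
          (cμ : ℂ) * ((Kδ : ℂ) *
            ((((T : ℝ) : ℂ) ^ s₁ / s₁) * (∫ x in {x : (AdeleRing (𝓞 E) E)ˣ | (IdeleClassGroup.ideleNorm E x : ℝ) ≤ 1} ∩ 𝓕I, ((IdeleClassGroup.ideleNorm E x : ℝ) : ℂ) * Ψ₁ x ∂νI)
              + (((T : ℝ) : ℂ) ^ s₂ / s₂) * (∫ x in {x : (AdeleRing (𝓞 E) E)ˣ | (IdeleClassGroup.ideleNorm E x : ℝ) ≤ 1} ∩ 𝓕I, ((IdeleClassGroup.ideleNorm E x : ℝ) : ℂ) * Ψ₂ x ∂νI)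
              - (((T : ℝ) : ℂ) ^ (-s₂) / s₂) * (∫ x in {x : (AdeleRing (𝓞 E) E)ˣ | (IdeleClassGroup.ideleNorm E x : ℝ) ≤ 1} ∩ 𝓕I, ((IdeleClassGroup.ideleNorm E x : ℝ) : ℂ) * Ψ₃ x ∂νI)
              - (((T : ℝ) : ℂ) ^ (-s₁) / s₁) * (∫ x in {x : (AdeleRing (𝓞 E) E)ˣ | (IdeleClassGroup.ideleNorm E x : ℝ) ≤ 1} ∩ 𝓕I, ((IdeleClassGroup.ideleNorm E x : ℝ) : ℂ) * Ψ₄ x ∂νI))) := by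
  obtain ⟨cμ, hcμ, h0⟩ := exists_integral_quotFun_truncation_mul_conj_eq_mul_integral_weight (N := 3) siegel_three μ νG
  refine ⟨cμ, hcμ, ?_⟩
  intro β hβ ν 𝓕 T hT f Mf f' Mf' Λ' CT' M M' hfm hMfm hf hMf hCT hsum hΛm hΛG M₁ hΛbdd hψL1 hAVG hCT' hadj hM'ψ hi₁ hi₂ hi₃ hi₄ hi₅
    Kδ s₁ s₂ hs₁ hs₂ Ψ₁ Ψ₂ Ψ₃ Ψ₄ hΨ₁m C₁ hΨ₁C hΨ₁K hΨ₁M hΨ₂m C₂ hΨ₂C hΨ₂K hΨ₂M hΨ₃m C₃ hΨ₃C hΨ₃K hΨ₃M hΨ₄m C₄ hΨ₄C hΨ₄K hΨ₄M hδ₁ hδ₂ hδ₃ hδ₄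
  have hT0 : (0 : ℝ) < (T : ℝ) := lt_of_lt_of_le one_pos (by exact_mod_cast hT)
  rw [(h0 hβ hT hfm hMfm hf hMf hCT hsum hΛm hΛG hΛbdd hψL1).2,
    integral_weight_psi_mul_conj_eq_four_brackets νG β (fun g => borelHeight g) T f Mf f' Mf' Λ' CT' M M' hAVG hCT' hadj hM'ψ hi₁ hi₂ hi₃ hi₄ hi₅,
    hδ₁, hδ₂, hδ₃, hδ₄,
    (integrableOn_and_setIntegral_normSq_inv_smul_indicator_le νI h𝓕I hΨ₁m hΨ₁C hΨ₁K hΨ₁M hs₁ hT0).2,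
    (integrableOn_and_setIntegral_normSq_inv_smul_indicator_le νI h𝓕I hΨ₂m hΨ₂C hΨ₂K hΨ₂M hs₂ hT0).2,
    (integrableOn_and_setIntegral_normSq_inv_smul_indicator_lt νI h𝓕I hΨ₃m hΨ₃C hΨ₃K hΨ₃M hs₂ hT0).2,
    (integrableOn_and_setIntegral_normSq_inv_smul_indicator_lt νI h𝓕I hΨ₄m hΨ₄C hΨ₄K hΨ₄M hs₁ hT0).2]
  ring

end Three

/-! ## §3 Cross terms: a bracket against a non-trivial character of the compact idele class group vanishes -/

section Cross

variable {K : Type} [Field K] [NumberField K]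
variable [MeasurableSpace (GaloisRepresentations.ideleGroup K)] [BorelSpace (GaloisRepresentations.ideleGroup K)]

/-- **CROSS TERMS VANISH**: `[a·η] = 0` for a constant `a` and a measurable bounded multiplicative `η : 𝕀_K →* ℂ` trivial on `K^×` and on `M` with `η x₀ ≠ 1` — so in §2, when the
`d₀`-pushed torus characters of `f` and `f′` differ (`Ψ₂ = a₂·η`, `Ψ₃ = a₃·η`), the two middle Mellin terms drop and the Maass–Selberg relation has TWO terms (★ p857517
`bracket_character_eq_zero`; the `U(1)`-fibre branch of the dichotomy is ★ p857588). [cite: MoeglinWaldspurger1995, IV.2.1] [cite: WeilBNT1967, Ch. VII §5] -/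
theorem bracket_const_mul_character_eq_zero (ν : Measure (GaloisRepresentations.ideleGroup K)) [ν.IsMulLeftInvariant]
    [IsFiniteMeasureOnCompacts ν] [ν.IsOpenPosMeasure] {𝓕 : Set (GaloisRepresentations.ideleGroup K)} (h𝓕 : IsIdeleClassDomain K 𝓕)
    (η : GaloisRepresentations.ideleGroup K →* ℂ) (hηm : Measurable η) {C : ℝ} (hηC : ∀ x, ‖η x‖ ≤ C)
    (hηK : ∀ k ∈ GaloisRepresentations.principalIdeles K, η k = 1) (hηM : ∀ r : ℝ≥0ˣ, η (posRealIdele K r) = 1)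
    {x₀ : GaloisRepresentations.ideleGroup K} (hx₀ : η x₀ ≠ 1) (a : ℂ) :
    ∫ x in {x | (IdeleClassGroup.ideleNorm K x : ℝ) ≤ 1} ∩ 𝓕, ((IdeleClassGroup.ideleNorm K x : ℝ) : ℂ) * (a * η x) ∂ν = 0 := by
  have h : ∀ x : GaloisRepresentations.ideleGroup K, ((IdeleClassGroup.ideleNorm K x : ℝ) : ℂ) * (a * η x) = a * (((IdeleClassGroup.ideleNorm K x : ℝ) : ℂ) * η x) :=
    fun x => by ring
  simp_rw [h]
  rw [integral_const_mul, bracket_character_eq_zero ν h𝓕 η hηm hηC hηK hηM hx₀, mul_zero]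

end Cross

end Summit.HodgeConjecture.HodgeConjecture.Cruxes.H413.K2E1MaassSelbergU

end
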